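import Literature.Computability.AlgebraicComplexity.FSV18JacobianCriterionPosChar
import Literature.RingTheory.Nullstellensatz.PerronCoordinateDegreeBound
import HarnessLib

/-!
# FSV 2018 Fact 51 (the Jacobian criterion of Beecken–Mittmann–Saxena) over EVERY field,
# unconditionally — val-lit t18 g2

M. Beecken, J. Mittmann, N. Saxena, *Algebraic independence and blackbox identity testing*
(arXiv:1102.2789), **Thm. 6:** «Let `f_1, …, f_m ∈ K[x]` be polynomials of degree at most `δ` and
trdeg `r`. Assume that `ch(K) = 0` or `ch(K) > δ^r`. Then `rk_L J_x(f) = trdeg_K{f}`», quoted by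
Forbes–Shpilka–Volk (ToC 14 (2018)) as **Fact 51** = the named fact `ForbesShpilkaVolk2018_fact51`
(`FSV2018ROABP`). The tree so far: `≤` in every characteristic (`jacobianRank_le_of_trdegLE`),
`≥` proved in characteristic `0` (`FSV18JacobianCriterionCharZero`), and in characteristic
`p > δ^r` modulo the cited sharp Perron theorem `perronTheorem_sharp`
(`FSV18JacobianCriterionPosChar`).

This file removes that last dependence, following the PRINTED proof of [BMS13] App. A with one
observation: the argument «By Theorem 4 … we have `deg(F_i) ≤ δ^r`. Hence, by the assumptions on
`ch(K)`, we have `∂_{y_0}F_i ≠ 0`. Since the degree of `F_i` was chosen to be minimal,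
`(∂_{y_0}F_i)(x_i, f_1, …, f_r, x_{r+1}, …, x_n) ≠ 0`» only ever uses the **`y_0`-degree** of the
relation `F_i` — choose `F_i` of minimal `y_0`-degree instead of minimal total degree — and the
bound `deg_{y_0} F_i ≤ δ^r` is the PROVED dimension count
`Literature.RingTheory.Nullstellensatz.exists_relation_degreeOf_le_pow_sum`
(`PerronCoordinateDegreeBound`). Structure (theorems only; no definitions, no new facts):

* `degreeOf_pderiv_lt`, `notMem_vars_of_pderiv_eq_zero_of_degreeOf` — «`∂_{y_0}F_i ≠ 0`» from
  a bound on the `y_0`-degree only;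
* `det_jacobianMatrix_ne_zero_of_algebraicIndependent_of_degreeOfBound` — the square step
  (Humphreys § 3.10 «⟹» = t21's `det_jacobianMatrix_ne_zero_of_algebraicIndependent_of_degreeBound`
  re-run with minimal `y_0`-degree);
* `card_le_jacobianRank_of_algebraicIndependent_of_det` — the rectangular step of the PosChar
  file with the square non-vanishing as a hypothesis (matroid exchange
  `exists_isTranscendenceBasis_between`, verbatim);
* `exists_relation_degreeOf_le_of_mem` — the relations of `y_0`-degree `≤ δ^r` for a square family
  drawn from `{F_i}_{i ∈ S} ∪ {X_j}` (re-indexing the variables into «`x_1, …, x_r`» and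
  «`x_{r+1}, …, x_n`» and applying `exists_relation_degreeOf_le_pow_sum`);
* **`ForbesShpilkaVolk2018_fact51_allFields (F) : ForbesShpilkaVolk2018_fact51 F` for every field `F`**
  (the fact takes the field as a parameter, so its discharge carries the binder `(F : Type*) [Field F]`).

Honest framing: FSV Fact 51 = [BMS13] Thm. 6 becomes a THEOREM of the tree over every field; N1
support for the val-lit NP corpus (it feeds `ForbesShpilkaVolk2018_lemma52_of_fact51`, hence FSV
Lemma 52 / Lemma 53 and the §6 bullet of FSV Thm. 9 over every field). `VP ≠ VNP` is NOT proved.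

## References
* [BeeckenMittmannSaxena2013] Thm. 4, Thm. 6 and App. A (arXiv:1102.2789 pp. 5, 14).
  locator: paper:arxiv-1102.2789 p0005.txt:L31–L36, p0014.txt:L53–L100
* [ForbesShpilkaVolk2018] Fact 51 (seq.) = arXiv v2 / ToC Fact 6.2.
* [Humphreys1990] § 3.10 (square criterion; tree `Literature.Algebra.Polynomial.JacobianCriterion`).
-/

noncomputable section

open MvPolynomial Finset Matrix
open scoped BigOperators Matrix

namespace Literature.Computability.AlgebraicComplexity

open Literature.Algebra.Polynomial.JacobianCriterion Literature.RingTheory.Nullstellensatz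

universe u v

/-! ### «`∂_{y_0} F_i ≠ 0`» from the `y_0`-degree -/

section Y0Degree

variable {K : Type u} [Field K] {σ : Type v}

/-- A non-zero partial derivative `∂p/∂xᵢ` has smaller `xᵢ`-degree than `p` (every monomial of
`∂p/∂xᵢ` is a monomial of `p` with the `xᵢ`-exponent lowered by one).
[cite: BeeckenMittmannSaxena2013, App. A, proof of Thm. 6 ("Since the degree of F_i was chosen to be minimal")]
locator: paper:arxiv-1102.2789 p0014.txt:L84–L86 -/
theorem degreeOf_pderiv_lt {i : σ} {p : MvPolynomial σ K} (hp : pderiv i p ≠ 0) :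
    degreeOf i (pderiv i p) < degreeOf i p := by
  classical
  have key : ∀ m ∈ (pderiv i p).support, m + Finsupp.single i 1 ∈ p.support := by
    intro m hm
    rw [mem_support_iff, coeff_pderiv] at hm
    exact mem_support_iff.mpr (left_ne_zero_of_mul hm)
  have hle : ∀ m ∈ (pderiv i p).support, m i + 1 ≤ degreeOf i p := by
    intro m hm
    have h := monomial_le_degreeOf i (key m hm)
    simpa [Finsupp.single_eq_same] using h
  have hpos : 0 < degreeOf i p := by
    obtain ⟨m, hm⟩ := Finset.nonempty_iff_ne_empty.mpr (support_eq_empty.not.mpr hp)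
    have := hle m hm
    omega
  rw [degreeOf_lt_iff hpos]
  intro m hm
  have := hle m hm
  omega

/-- If `∂p/∂xᵢ = 0` and every exponent `e` with `1 ≤ e ≤ deg_{xᵢ} p` is non-zero in `K` (e.g.
`char K = 0` or `char K > deg_{xᵢ} p`), then `xᵢ` does not occur in `p` — the `xᵢ`-DEGREE form
of t21's `notMem_vars_of_pderiv_eq_zero_of_cast_ne_zero` (total degree), same proof.
[cite: BeeckenMittmannSaxena2013, App. A, proof of Thm. 6 ("by the assumptions on ch(K), we have ∂_{y₀}F_i ≠ 0")]
locator: paper:arxiv-1102.2789 p0014.txt:L81–L84 -/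
theorem notMem_vars_of_pderiv_eq_zero_of_degreeOf {i : σ} {p : MvPolynomial σ K}
    (hp : pderiv i p = 0) (hdeg : ∀ e : ℕ, 1 ≤ e → e ≤ degreeOf i p → (e : K) ≠ 0) :
    i ∉ p.vars := by
  classical
  intro hi
  obtain ⟨s, hs, his⟩ := (mem_vars_iff_mem_support i).mp hi
  have hsi : s i ≠ 0 := Finsupp.mem_support_iff.mp his
  have e : s = (s - Finsupp.single i 1) + Finsupp.single i 1 := by
    ext j
    simp only [Finsupp.coe_add, Finsupp.coe_tsub, Pi.add_apply, Pi.sub_apply, Finsupp.single_apply]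
    split_ifs with h
    · subst h; omega
    · omega
  have h := coeff_pderiv (i := i) p (s - Finsupp.single i 1)
  rw [hp, coeff_zero, ← e] at h
  rcases mul_eq_zero.mp h.symm with h' | h'
  · exact (mem_support_iff.mp hs) h'
  · refine hdeg (s i) (Nat.one_le_iff_ne_zero.mpr hsi) (monomial_le_degreeOf i hs) ?_
    have hcast : ((s i : ℕ) : K) = (((s - Finsupp.single i 1 : σ →₀ ℕ) i : ℕ) : K) + 1 := by
      have : s i = (s - Finsupp.single i 1 : σ →₀ ℕ) i + 1 := by
        simp only [Finsupp.coe_tsub, Pi.sub_apply, Finsupp.single_eq_same]; omega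
      rw [this, Nat.cast_add, Nat.cast_one]
    rw [hcast]
    exact h'

end Y0Degree

/-! ### The square step with relations of bounded `y_0`-degree -/

section Square

variable {K : Type u} [Field K] {ι : Type v} [Fintype ι] [DecidableEq ι]

/-- **The Jacobian criterion, square case, «⟹» in ANY characteristic under a bound on the
`y_0`-degree of the relations** ([BMS13] App. A with «minimal degree» read as minimal
`y_0`-degree): let `f₁, …, fₙ ∈ K[x₁, …, xₙ]` be algebraically independent and suppose that for
each `i` the family `xᵢ, f₁, …, fₙ` has a non-zero relation `H` with `deg_{y_0} H ≤ B`, where every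
`1 ≤ e ≤ B` is non-zero in `K`. Then `J(f₁, …, fₙ) ≠ 0`. Proof as printed: a relation `Hᵢ` of
least `y_0`-degree has `1 ≤ deg_{y_0} Hᵢ ≤ B` (it involves `y_0` by the independence of the `fⱼ`),
so `∂Hᵢ/∂y₀ ≠ 0`, and `(∂Hᵢ/∂y₀)(xᵢ, f) ≠ 0` by minimality (`∂Hᵢ/∂y₀` has smaller `y_0`-degree,
and if that degree is `0` it is a relation among the `fⱼ` alone); the chain rule gives
`N · J = −diag(wᵢ)` with `wᵢ ≠ 0`.
[cite: BeeckenMittmannSaxena2013, App. A (proof of Thm. 6); Humphreys1990, § 3.10 Proposition (⇒)]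
locator: paper:arxiv-1102.2789 p0014.txt:L53–L100 -/
theorem det_jacobianMatrix_ne_zero_of_algebraicIndependent_of_degreeOfBound
    (f : ι → MvPolynomial ι K) (hf : AlgebraicIndependent K f) (B : ℕ)
    (hrel : ∀ i, ∃ H : MvPolynomial (Option ι) K, H ≠ 0 ∧
      aeval (fun o : Option ι => o.elim (X i) f) H = 0 ∧ degreeOf none H ≤ B)
    (hB : ∀ e : ℕ, 1 ≤ e → e ≤ B → (e : K) ≠ 0) :
    (jacobianMatrix f).det ≠ 0 := by
  classical
  -- for each `i`: a relation `H` of least `y_0`-degree, with `(∂H/∂y₀)(xᵢ, f) ≠ 0`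
  have key : ∀ i, ∃ H : MvPolynomial (Option ι) K,
      aeval (fun o : Option ι => o.elim (X i) f) H = 0 ∧
        aeval (fun o : Option ι => o.elim (X i) f) (pderiv none H) ≠ 0 := by
    intro i
    set g : Option ι → MvPolynomial ι K := fun o => o.elim (X i) f with hg
    have hex : ∃ m, ∃ H : MvPolynomial (Option ι) K, H ≠ 0 ∧ aeval g H = 0 ∧
        degreeOf none H = m := by
      obtain ⟨H, hne, h0, -⟩ := hrel i
      exact ⟨_, H, hne, h0, rfl⟩
    obtain ⟨H, hne, h0, hm⟩ := Nat.find_spec hex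
    -- the least `y_0`-degree is `≤ B`
    have hmB : Nat.find hex ≤ B := by
      obtain ⟨H', hne', h0', hB'⟩ := hrel i
      exact (Nat.find_min' hex ⟨H', hne', h0', rfl⟩).trans hB'
    refine ⟨H, h0, fun hw => ?_⟩
    -- `∂H/∂y₀ ≠ 0`: otherwise `H` is a relation among the `fⱼ` alone
    have hd : pderiv none H ≠ 0 := by
      intro hd
      have hvars : (↑H.vars : Set (Option ι)) ⊆ Set.range (some : ι → Option ι) := by
        intro o ho
        cases o with
        | none =>
          refine absurd ho (notMem_vars_of_pderiv_eq_zero_of_degreeOf hd fun e h1 h2 => ?_)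
          exact hB e h1 (h2.trans (hm.le.trans hmB))
        | some j => exact ⟨j, rfl⟩
      obtain ⟨H', rfl⟩ := exists_rename_eq_of_vars_subset_range H some (Option.some_injective ι) hvars
      rw [aeval_rename] at h0
      have hgf : g ∘ some = f := funext fun j => rfl
      rw [hgf] at h0
      have hH' : H' = 0 := algebraicIndependent_iff.mp hf H' h0
      exact hne (by rw [hH', map_zero])
    exact Nat.find_min hex (hm ▸ degreeOf_pderiv_lt hd) ⟨_, hd, hw, rfl⟩
  choose H hH0 hw using key
  -- the matrix identity (27): `N * (∂fⱼ/∂x_k) = −diag(wᵢ)`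
  set N : Matrix ι ι (MvPolynomial ι K) :=
    Matrix.of fun i j => aeval (fun o : Option ι => o.elim (X i) f) (pderiv (some j) (H i)) with hN
  set w : ι → MvPolynomial ι K :=
    fun i => aeval (fun o : Option ι => o.elim (X i) f) (pderiv none (H i)) with hw'
  have h27 : N * jacobianMatrix f = -Matrix.diagonal w := by
    refine Matrix.ext fun i k => ?_
    have hc := pderiv_aeval (fun o : Option ι => o.elim (X i) f) (H i) k
    rw [hH0 i, map_zero, Fintype.sum_option] at hc
    simp only [Option.elim_none, Option.elim_some, pderiv_X] at hc
    rw [Matrix.mul_apply, Matrix.neg_apply, Matrix.diagonal_apply]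
    simp only [hN, Matrix.of_apply, jacobianMatrix_apply]
    rw [eq_neg_iff_add_eq_zero, add_comm]
    have e : (if i = k then w i else 0) =
        aeval (fun o : Option ι => o.elim (X i) f) (pderiv none (H i)) *
          (Pi.single k 1 : ι → MvPolynomial ι K) i := by
      rw [Pi.single_apply, mul_ite, mul_one, mul_zero]
    rw [e]
    exact hc.symm
  -- determinants
  intro hJ
  have hdet := congrArg Matrix.det h27
  rw [Matrix.det_mul, hJ, mul_zero, Matrix.det_neg, Matrix.det_diagonal] at hdet
  refine (mul_ne_zero (pow_ne_zero _ (neg_ne_zero.mpr one_ne_zero))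
    (Finset.prod_ne_zero_iff.mpr fun i _ => hw i)) hdet.symm

end Square

/-! ### The rectangular step, with the square non-vanishing as the hypothesis -/

section Rectangular

variable {F : Type u} [Field F]

set_option synthInstance.maxHeartbeats 400000 in
/-- **The Jacobian criterion, rectangular form, `≥`-half** — t21's
`card_le_jacobianRank_of_algebraicIndependent_of_degreeBound` with the square Jacobian
non-vanishing taken as the hypothesis (the printed reduction «we may assume that
`f_1, …, f_r, x_{r+1}, …, x_n` are algebraically independent»: extend `{F_i}_{i ∈ S}` by variables
to a transcendence basis, `exists_isTranscendenceBasis_between`; its rows are rows of `Jac(F)` or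
unit vectors), proof verbatim.
[cite: BeeckenMittmannSaxena2013, App. A (proof of Thm. 6); ForbesShpilkaVolk2018, Fact 51 (seq.; = ToC Fact 6.2)]
locator: paper:arxiv-1102.2789 p0014.txt:L60–L100 -/
theorem card_le_jacobianRank_of_algebraicIndependent_of_det {N M : ℕ}
    (Fv : Fin M → MvPolynomial (Fin N) F) (S : Finset (Fin M))
    (hind : AlgebraicIndependent F fun i : S => Fv i)
    (hsq : ∀ g : Fin N → MvPolynomial (Fin N) F, AlgebraicIndependent F g →
      (∀ j, g j ∈ (Set.range fun i : S => Fv i) ∪ Set.range (X : Fin N → MvPolynomial (Fin N) F)) →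
      (jacobianMatrix g).det ≠ 0) :
    S.card ≤ jacobianRank Fv := by
  classical
  -- notation (`A = 𝔽[X]`, `K = 𝔽(X)`)
  let K := FractionRing (MvPolynomial (Fin N) F)
  let toK := algebraMap (MvPolynomial (Fin N) F) K
  set J := jacobianMatrix Fv with hJ
  have hrank : jacobianRank Fv = (J.map toK).rank := rfl
  -- the set `s` of the `F_i`, `i ∈ S`, and `t = s ∪ {X_j}`
  set s : Set (MvPolynomial (Fin N) F) := Set.range fun i : S => Fv i with hs
  have hsind : AlgebraicIndepOn F id s := by
    simpa [AlgebraicIndepOn] using hind.to_subtype_range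
  set t : Set (MvPolynomial (Fin N) F) := s ∪ Set.range (X : Fin N → MvPolynomial (Fin N) F) with ht
  have htop : Algebra.adjoin F t = ⊤ := by
    refine top_le_iff.mp ?_
    rw [← MvPolynomial.adjoin_range_X]
    exact Algebra.adjoin_mono Set.subset_union_right
  haveI : Algebra.IsAlgebraic (Algebra.adjoin F t) (MvPolynomial (Fin N) F) := by
    rw [htop]
    haveI := Algebra.isIntegral_of_surjective
      (R := (⊤ : Subalgebra F (MvPolynomial (Fin N) F))) (B := MvPolynomial (Fin N) F)
      (fun a => ⟨⟨a, Algebra.mem_top⟩, rfl⟩)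
    infer_instance
  -- a transcendence basis `u` between `s` and `t`
  obtain ⟨u, hsu, hut, hu⟩ := exists_isTranscendenceBasis_between s t Set.subset_union_left hsind
  -- `|u| = N`
  have hcard : Cardinal.mk u = N := by
    have h := hu.lift_cardinalMk_eq (IsTranscendenceBasis.mvPolynomial (Fin N) F)
    rw [Cardinal.mk_fin, Cardinal.lift_natCast, Cardinal.lift_eq_nat_iff] at h
    exact h
  obtain ⟨e⟩ := Cardinal.mk_eq_nat_iff.mp hcard
  have hufin : u.Finite := Set.finite_coe_iff.mp (Finite.of_equiv _ e.symm)
  have huN : u.ncard = N := by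
    rw [← Nat.card_coe_set_eq, Nat.card_congr e, Nat.card_fin]
  -- `|s| = |S|`
  have hsr : s.ncard = S.card := by
    rw [hs, Set.ncard_range_of_injective hind.injective, Nat.card_eq_fintype_card, Fintype.card_coe]
  -- the square family `g : Fin N → A` enumerating `u`
  let g : Fin N → MvPolynomial (Fin N) F := fun j => (e.symm j : MvPolynomial (Fin N) F)
  have hg : AlgebraicIndependent F g := hu.1.comp _ e.symm.injective
  have hgt : ∀ j, g j ∈ s ∪ Set.range (X : Fin N → MvPolynomial (Fin N) F) := fun j => hut (e.symm j).2
  have hdet : (jacobianMatrix g).det ≠ 0 := hsq g hg hgt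
  -- its Jacobian has rank `N` over `K`
  have hrankg : ((jacobianMatrix g).map toK).rank = N := by
    have hU : IsUnit ((jacobianMatrix g).map toK) := by
      rw [Matrix.isUnit_iff_isUnit_det, isUnit_iff_ne_zero, ← RingHom.mapMatrix_apply,
        ← RingHom.map_det]
      exact fun h0 => hdet (IsFractionRing.injective (MvPolynomial (Fin N) F) K (by rw [h0, map_zero]))
    rw [Matrix.rank_of_isUnit _ hU, Fintype.card_fin]
  -- the variables in `u` but not in `s`
  set T : Finset (Fin N) :=
    Finset.univ.filter fun k => (X k : MvPolynomial (Fin N) F) ∈ u ∧ (X k : MvPolynomial (Fin N) F) ∉ s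
    with hT
  have hTcard : T.card + S.card ≤ N := by
    have h1 : T.card ≤ (u \ s).ncard := by
      rw [Set.ncard_eq_toFinset_card _ (hufin.subset Set.sdiff_subset)]
      refine Finset.card_le_card_of_injOn (fun k => (X k : MvPolynomial (Fin N) F)) (fun k hk => ?_) ?_
      · rw [Finset.mem_coe] at hk
        simp only [Set.Finite.coe_toFinset]
        exact (Finset.mem_filter.1 hk).2
      · intro k _ k' _ hkk'
        exact X_injective hkk'
    have h2 := Set.ncard_sdiff_add_ncard_of_subset hsu hufin
    omega
  -- every row of `Jac(g)` is a row of `Jac(F)|_S` or a unit vector `e_k`, `k ∈ T`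
  let JS : Matrix S (Fin N) K := (J.map toK).submatrix (fun i : S => (i : Fin M)) id
  let V₁ : Submodule K (Fin N → K) := Submodule.span K (Set.range JS.row)
  let V₂ : Submodule K (Fin N → K) := Submodule.span K (Set.range fun k : T => Pi.single (k : Fin N) (1 : K))
  have hrows : Set.range ((jacobianMatrix g).map toK).row ⊆ (V₁ ⊔ V₂ : Submodule K (Fin N → K)) := by
    rintro _ ⟨j, rfl⟩
    have hju : (e.symm j : MvPolynomial (Fin N) F) ∈ u := (e.symm j).2
    by_cases hjs : (e.symm j : MvPolynomial (Fin N) F) ∈ s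
    · -- a row of `Jac(F)`
      obtain ⟨i, hi⟩ := hjs
      have hgj : g j = Fv i := hi.symm
      have hrow : ((jacobianMatrix g).map toK).row j = JS.row i := by
        funext k
        show toK (pderiv k (g j)) = toK (pderiv k (Fv i))
        rw [hgj]
      rw [hrow]
      exact Submodule.mem_sup_left (Submodule.subset_span ⟨i, rfl⟩)
    · -- a variable: unit row
      have hjt := hut hju
      rcases hjt with hjs' | ⟨k, hk⟩
      · exact absurd hjs' hjs
      have hkT : k ∈ T := Finset.mem_filter.2 ⟨Finset.mem_univ _, hk ▸ hju, hk ▸ hjs⟩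
      have hgj : g j = X k := hk.symm
      have hrow : ((jacobianMatrix g).map toK).row j = Pi.single k 1 := by
        funext k'
        show toK (pderiv k' (g j)) = (Pi.single k (1 : K) : Fin N → K) k'
        rw [hgj, pderiv_X]
        by_cases hkk : k' = k
        · subst hkk
          simp
        · rw [Pi.single_eq_of_ne (Ne.symm hkk), Pi.single_eq_of_ne hkk, map_zero]
      rw [hrow]
      exact Submodule.mem_sup_right (Submodule.subset_span ⟨⟨k, hkT⟩, rfl⟩)
  -- ranks
  have hN : (N : ℕ) ≤ Module.finrank K V₁ + Module.finrank K V₂ := by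
    calc N = ((jacobianMatrix g).map toK).rank := hrankg.symm
      _ = Module.finrank K (Submodule.span K (Set.range ((jacobianMatrix g).map toK).row)) :=
          Matrix.rank_eq_finrank_span_row _
      _ ≤ Module.finrank K (V₁ ⊔ V₂ : Submodule K (Fin N → K)) :=
          Submodule.finrank_mono (Submodule.span_le.2 hrows)
      _ ≤ Module.finrank K V₁ + Module.finrank K V₂ := Submodule.finrank_add_le_finrank_add_finrank _ _
  have hV₁ : Module.finrank K V₁ ≤ jacobianRank Fv := by
    rw [hrank, show Module.finrank K V₁ = JS.rank from (Matrix.rank_eq_finrank_span_row JS).symm]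
    exact Matrix.rank_submatrix_le _ _ _
  have hV₂ : Module.finrank K V₂ ≤ T.card := by
    simpa [Set.finrank] using
      finrank_range_le_card (R := K) fun k : T => (Pi.single (k : Fin N) (1 : K) : Fin N → K)
  omega

end Rectangular

/-! ### The relations of `y_0`-degree `≤ δ^r` for a square family drawn from `{F_i} ∪ {X_j}` -/

section Relations

variable {F : Type u} [Field F]

/-- **«By Theorem 4 (with `(n−r+1)` of the `δ_i`'s being `1`), we have `deg(F_i) ≤ δ^r`» — the
`y_0`-degree part, PROVED:** let `g = (g_1, …, g_N)` be an algebraically independent family in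
`𝔽[X_1, …, X_N]` each member of which is one of the `F_k` (`k ∈ S`, `deg F_k ≤ d`) or a variable.
Then for every `i` there is a non-zero `H ∈ 𝔽[y_0, y_1, …, y_N]` with `H(X_i, g) = 0` and
`deg_{y_0} H ≤ (max d 1)^{|S|}`. Proof: if `X_i` is among the `g_j`, take `H = y_0 − y_j`;
otherwise split the variables into those NOT among the `g_j` (a set `σ ∋ i`, in bijection with the
non-variable members of `g`, at most `|S|` of them) and those among the `g_j` (`τ`), and apply
`exists_relation_degreeOf_le_pow_sum` (the dimension count of `PerronCoordinateDegreeBound`).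
[cite: BeeckenMittmannSaxena2013, Thm. 4 and App. A (proof of Thm. 6)]
locator: paper:arxiv-1102.2789 p0014.txt:L74–L84 -/
theorem exists_relation_degreeOf_le_of_mem {N M d : ℕ} (Fv : Fin M → MvPolynomial (Fin N) F)
    (hdeg : ∀ k, (Fv k).totalDegree ≤ d) (S : Finset (Fin M))
    (g : Fin N → MvPolynomial (Fin N) F) (hg : AlgebraicIndependent F g)
    (hgt : ∀ j, g j ∈ (Set.range fun k : S => Fv k) ∪
      Set.range (X : Fin N → MvPolynomial (Fin N) F))
    (i : Fin N) :
    ∃ H : MvPolynomial (Option (Fin N)) F, H ≠ 0 ∧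
      aeval (fun o : Option (Fin N) => o.elim (X i) g) H = 0 ∧ degreeOf none H ≤ (max d 1) ^ S.card := by
  classical
  set δ := max d 1 with hδ
  have hδ1 : 1 ≤ δ := le_max_right _ _
  -- Case 1: `X_i` is one of the `g_j`
  by_cases hiV : (X i : MvPolynomial (Fin N) F) ∈ Set.range g
  · obtain ⟨j₀, hj₀⟩ := hiV
    refine ⟨X none - X (some j₀), ?_, ?_, ?_⟩
    · intro h
      have h1 := congrArg (coeff (Finsupp.single none 1)) h
      simp only [coeff_sub, coeff_X, coeff_zero, if_true] at h1
      rw [if_neg] at h1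
      · simp at h1
      · intro h2
        have := Finsupp.single_eq_single_iff _ _ _ _ |>.mp h2
        simp at this
    · simp [hj₀]
    · refine (degreeOf_sub_le _ _ _).trans ?_
      rw [degreeOf_X, degreeOf_X, if_pos rfl, if_neg (Option.some_ne_none j₀).symm]
      simp only [max_eq_left (Nat.zero_le 1)]
      exact Nat.one_le_pow _ _ hδ1
  -- Case 2: `X_i` is not among the `g_j`.  Variables among the `g_j` (`τ`) and the rest (`σ`).
  set pτ : Fin N → Prop := fun k => (X k : MvPolynomial (Fin N) F) ∈ Set.range g with hpτ
  let σ := {k : Fin N // ¬ pτ k}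
  let τ := {k : Fin N // pτ k}
  -- the re-indexing of the variables `σ ⊕ τ ≃ Fin N`
  let eV : σ ⊕ τ ≃ Fin N := (Equiv.sumComm _ _).trans (Equiv.sumCompl pτ)
  have heVl : ∀ s : σ, eV (Sum.inl s) = s.1 := fun s => by
    show Equiv.sumCompl pτ (Sum.inr s) = s.1
    exact Equiv.sumCompl_apply_inr s
  have heVr : ∀ t : τ, eV (Sum.inr t) = t.1 := fun t => by
    show Equiv.sumCompl pτ (Sum.inl t) = t.1
    exact Equiv.sumCompl_apply_inl t
  -- the non-variable members of `g`: positions `J`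
  let Jn := {j : Fin N // g j ∉ Set.range (X : Fin N → MvPolynomial (Fin N) F)}
  -- for `t ∈ τ`, the position `jτ t` with `g (jτ t) = X t`
  have hτ : ∀ t : τ, ∃ j, g j = X t.1 := fun t => by
    obtain ⟨j, hj⟩ := t.2
    exact ⟨j, hj⟩
  choose jτ hjτ using hτ
  -- `|σ| = |Jn|`: both are complements of `|τ| = #(variable positions)`
  have hginj : Function.Injective g := hg.injective
  have hcardστ : Fintype.card σ + Fintype.card τ = N := by
    have := Fintype.card_congr eV
    simp only [Fintype.card_sum, Fintype.card_fin] at this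
    omega
  -- positions holding variables are in bijection with `τ`
  let Jv := {j : Fin N // g j ∈ Set.range (X : Fin N → MvPolynomial (Fin N) F)}
  have hJv : Fintype.card Jv = Fintype.card τ := by
    refine Fintype.card_congr ?_
    refine Equiv.ofBijective (fun t : τ => (⟨jτ t, ⟨t.1, (hjτ t).symm⟩⟩ : Jv)) ⟨?_, ?_⟩ |>.symm
    · intro t t' h
      have h1 : jτ t = jτ t' := congrArg Subtype.val h
      have h2 : (X t.1 : MvPolynomial (Fin N) F) = X t'.1 := by rw [← hjτ t, ← hjτ t', h1]
      exact Subtype.ext (X_injective h2)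
    · intro j
      obtain ⟨k, hk⟩ := j.2
      refine ⟨⟨k, ⟨j.1, hk.symm⟩⟩, Subtype.ext ?_⟩
      show jτ ⟨k, _⟩ = j.1
      exact hginj ((hjτ ⟨k, ⟨j.1, hk.symm⟩⟩).trans hk)
  have hJnJv : Fintype.card Jn + Fintype.card Jv = N := by
    have h := Fintype.card_congr
      (Equiv.sumCompl fun j : Fin N => g j ∈ Set.range (X : Fin N → MvPolynomial (Fin N) F))
    rw [Fintype.card_sum, Fintype.card_fin] at h
    have e1 : Fintype.card Jv =
        Fintype.card {a : Fin N // g a ∈ Set.range (X : Fin N → MvPolynomial (Fin N) F)} :=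
      Fintype.card_congr (Equiv.refl _)
    have e2 : Fintype.card Jn =
        Fintype.card {a : Fin N // ¬ g a ∈ Set.range (X : Fin N → MvPolynomial (Fin N) F)} :=
      Fintype.card_congr (Equiv.refl _)
    omega
  have hσJn : Fintype.card σ = Fintype.card Jn := by omega
  let β : σ ≃ Jn := Fintype.equivOfCardEq hσJn
  -- `|σ| ≤ |S|`: the non-variable members of `g` are distinct members of `{F_k}_{k ∈ S}`
  have hσS : Fintype.card σ ≤ S.card := by
    rw [hσJn]
    have hmem : ∀ j : Jn, g j.1 ∈ Set.range fun k : S => Fv k := fun j => by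
      rcases hgt j.1 with h | h
      · exact h
      · exact absurd h j.2
    choose kS hkS using hmem
    have hinj : Function.Injective kS := by
      intro j j' h
      apply Subtype.ext
      apply hginj
      rw [← hkS j, ← hkS j', h]
    calc Fintype.card Jn ≤ Fintype.card S := Fintype.card_le_of_injective kS hinj
      _ = S.card := Fintype.card_coe S
  -- the data for `exists_relation_degreeOf_le_pow_sum`
  let f : σ → MvPolynomial (σ ⊕ τ) F := fun s => rename eV.symm (g (β s).1)
  have hf : ∀ s, (f s).totalDegree ≤ δ := fun s => by
    refine (totalDegree_rename_le _ _).trans ?_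
    obtain ⟨k, hk⟩ : g (β s).1 ∈ Set.range fun k : S => Fv k := by
      rcases hgt (β s).1 with h | h
      · exact h
      · exact absurd h (β s).2
    rw [← hk]
    exact (hdeg _).trans (le_max_left _ _)
  have hiσ : ¬ pτ i := hiV
  obtain ⟨H₀, hH₀0, hH₀, hH₀deg⟩ :=
    exists_relation_degreeOf_le_pow_sum (K := F) hδ1 f hf ⟨i, hiσ⟩
  -- transport back along `θ : Option (σ ⊕ τ) → Option (Fin N)`
  let θ : Option (σ ⊕ τ) → Option (Fin N) := fun o =>
    o.elim none (Sum.elim (fun s => some (β s).1) (fun t => some (jτ t)))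
  have hθinj : Function.Injective θ := by
    have hsep : ∀ (s : σ) (t : τ), (β s).1 ≠ jτ t := by
      intro s t h
      apply (β s).2
      rw [h, hjτ t]
      exact ⟨t.1, rfl⟩
    have hjτinj : ∀ t t' : τ, jτ t = jτ t' → t = t' := by
      intro t t' h
      have h2 : (X t.1 : MvPolynomial (Fin N) F) = X t'.1 := by rw [← hjτ t, ← hjτ t', h]
      exact Subtype.ext (X_injective h2)
    rintro (_ | (s | t)) (_ | (s' | t')) h <;> simp only [θ, Option.elim_none, Option.elim_some,
      Sum.elim_inl, Sum.elim_inr, reduceCtorEq, Option.some.injEq] at h ⊢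
    · exact congrArg Sum.inl (β.injective (Subtype.ext h))
    · exact absurd h (hsep s t')
    · exact absurd h.symm (hsep s' t)
    · exact congrArg Sum.inr (hjτinj t t' h)
  refine ⟨rename θ H₀, ?_, ?_, ?_⟩
  · exact fun h0 => hH₀0 (rename_injective θ hθinj (by rw [h0, map_zero]))
  · have hcomp : (fun o : Option (Fin N) => o.elim (X i) g) ∘ θ =
        fun o => rename eV ((fun o : Option (σ ⊕ τ) =>
          o.elim (X (Sum.inl ⟨i, hiσ⟩)) (Sum.elim f fun t => X (Sum.inr t))) o) := by
      funext o
      rcases o with _ | (s | t)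
      · simp only [Function.comp_apply, θ, Option.elim_none, rename_X]
        rw [heVl]
      · simp only [Function.comp_apply, θ, Option.elim_some, Sum.elim_inl, f, rename_rename,
          Equiv.self_comp_symm, rename_id_apply]
      · simp only [Function.comp_apply, θ, Option.elim_some, Sum.elim_inr, rename_X]
        rw [heVr, hjτ]
    rw [aeval_rename, hcomp, ← comp_aeval, AlgHom.comp_apply, hH₀, map_zero]
  · have h := degreeOf_rename_of_injective hθinj (none : Option (σ ⊕ τ)) (p := H₀)
    have hθ0 : θ none = none := rfl
    rw [hθ0] at h
    rw [h]
    exact hH₀deg.trans (Nat.pow_le_pow_right hδ1 hσS)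

end Relations

/-! ### Fact 51 over every field -/

section Fact51

/-- **`≥`, unconditionally, in characteristic `0` or `> (max d 1)^{|S|}`:** the rectangular step
fed with the square step and the PROVED `y_0`-degree bound.
[cite: BeeckenMittmannSaxena2013, Thm. 6 and App. A (proof); ForbesShpilkaVolk2018, Fact 51 (seq.; = ToC Fact 6.2)]
locator: paper:arxiv-1102.2789 p0014.txt:L53–L100 -/
theorem card_le_jacobianRank_of_algebraicIndependent_allChar {F : Type u} [Field F] {N M d : ℕ}
    (Fv : Fin M → MvPolynomial (Fin N) F) (hdeg : ∀ i, (Fv i).totalDegree ≤ d)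
    (S : Finset (Fin M)) (hind : AlgebraicIndependent F fun i : S => Fv i)
    (hchar : ∀ e : ℕ, 1 ≤ e → e ≤ (max d 1) ^ S.card → (e : F) ≠ 0) :
    S.card ≤ jacobianRank Fv := by
  classical
  refine card_le_jacobianRank_of_algebraicIndependent_of_det Fv S hind fun g hg hgt => ?_
  exact det_jacobianMatrix_ne_zero_of_algebraicIndependent_of_degreeOfBound g hg _
    (fun i => exists_relation_degreeOf_le_of_mem Fv hdeg S g hg hgt i) hchar

/-- **FSV Fact 51 = [BMS13] Thm. 6 (the Jacobian criterion), BOTH clauses, over EVERY field —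
PROVED (no external fact):** for `F_1, …, F_m ∈ 𝔽[X_1, …, X_N]` of degree `≤ d` with
`trdeg{F} = r` and `char 𝔽 = 0 ∨ char 𝔽 > d^r`, `rank_{𝔽(X)} Jac_X(F) = r`. `≤` is
`jacobianRank_le_of_trdegLE` (any characteristic); `≥` is `card_le_jacobianRank_of_algebraicIndependent_allChar`
(for `d = 0` an algebraically independent subfamily is empty). This proves the named fact
`ForbesShpilkaVolk2018_fact51 F` for every field `F` (the fact is parametrised by the field, hence
the binder) and supersedes the conditional `ForbesShpilkaVolk2018_fact51_of_perron`.
[cite: ForbesShpilkaVolk2018, Fact 51 (seq.; = arXiv v2 / ToC Fact 6.2); BeeckenMittmannSaxena2013, Thm. 6 + App. A]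
locator: paper:arxiv-1701.05328 p0022.txt:L15; paper:arxiv-1102.2789 p0005.txt:L83–L86, p0014.txt:L53–L100 -/
theorem ForbesShpilkaVolk2018_fact51_allFields (F : Type*) [Field F] :
    ForbesShpilkaVolk2018_fact51 F := by
  classical
  intro N m d r Fv hdeg htr hS hchar
  obtain ⟨S, hSr, hind⟩ := hS
  refine le_antisymm (jacobianRank_le_of_trdegLE htr) ?_
  rw [← hSr]
  -- `d = 0`: all `F_i` are constants, so `S = ∅`
  rcases Nat.eq_zero_or_pos d with rfl | hd
  · rcases S.eq_empty_or_nonempty with rfl | ⟨i, hi⟩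
    · simp
    · exfalso
      have h1 := one_le_totalDegree_of_algebraicIndependent hind ⟨i, hi⟩
      have h0 := hdeg i
      simp only at h1
      omega
  refine card_le_jacobianRank_of_algebraicIndependent_allChar Fv hdeg S hind fun e h1 h2 => ?_
  rw [max_eq_left hd, hSr] at h2
  exact natCast_ne_zero_of_ringChar hchar h1 h2

end Fact51

end Literature.Computability.AlgebraicComplexity

end
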